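import Summits.CriticalPhenomena.PercolationContinuityZ3.Theorems.PercNearOneGluingNoHeavyLowerTailChampionStabilityRelay
import Summits.CriticalPhenomena.PercolationContinuityZ3.Theorems.PercNearOneGluingNoHeavyLowerTailHullPortScenarios
import Literature.Probability.LatticeModels.ProdBernoulliAtomExpansion
import HarnessLib

/-!
# `NoHeavyLowerTail` (stmt-CriticalPhenomena-4575) — CS₂ for two STAR ports when the champion survives one star

Route `PercNearOneGluingNoHeavy`, seat `prim-gen-swap` (gen 4); seat memo SILENT-PORTS.md §7–§9.  `μ = prodBernoulli w` on
`Fin n`, relays `A`, level `j`, `π(z) = {a ∈ A : z ↔ a}`, `R_a = {|π(a)| ≤ j}`.  Setting ("MS-STAR"): two non-relay vertices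
`u ≠ v` whose positive-weight neighbours are all relays; `w⁰` := `w` with every pair `s(v,b)`, `b ∈ A`, set to `0`.  The stub
`stub_championStabilityPair` at `(x,y) = (u,v)` is proved here for every `c ∈ A` that is a champion of `w⁰`; by symmetry this
covers every two-star instance except the "double switch" (champion of `w` a champion of neither one-star graph; memo §9).
Proof: disintegrate over the set `T` of `v`'s open star pairs (`HullPort.real_eq_sum_scenarios`); `T = ∅`: `v` is a.s.
isolated and the claim is the cumulative isolation lemma for the star observer `u` at the champion of `w⁰`
(`cumulativeIsolation_of_relayNeighbours`); `T ≠ ∅`: `v` is glued to the relays of `T` and `twoObserver_le_of_lonelier`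
applies once `μ_{w_T}(R_v) ≤ μ_{w_T}(R_c)` (`StarPair.glued_le`, by induction on `T`: `mergeStability_of_mem` then
`StarPair.mergeStability_obs_of_le`).  No definitions, no named facts, no sorries.
-/

noncomputable section

namespace Summit.CriticalPhenomena.PercolationContinuityZ3.Theorems

open MeasureTheory Set Literature.Probability.LatticeModels Literature.Probability.Percolation
open scoped Classical BigOperators

variable {n : ℕ}

namespace StarPair

open ChampionStability in
/-- After gluing the vertex `o` to the relay `v` (weight-0 pair raised to 1), `o`'s loneliness event and its
small-nonempty event coincide in probability: `μ_{w[ov↦1]}(|π(o)| ≤ j) = μ_{w[ov↦1]}(1 ≤ |π(o)| ≤ j)`. [this file] -/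
theorem real_update_one_obs_lonely_eq (w : Sym2 (Fin n) → unitInterval) (A : Finset (Fin n))
    (o v : Fin n) (j : ℕ) (hvo : v ≠ o) (hv : v ∈ A) (hw : w s(o, v) = 0) :
    (prodBernoulli (Function.update w s(o, v) 1)).real {ω : BondConfig (Fin n) |
        (A.filter fun x => ω ∈ openConn o x).card ≤ j} =
      (prodBernoulli (Function.update w s(o, v) 1)).real {ω : BondConfig (Fin n) |
        1 ≤ (A.filter fun x => ω ∈ openConn o x).card ∧ (A.filter fun x => ω ∈ openConn o x).card ≤ j} := by
  have hov : o ≠ v := fun h => hvo h.symm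
  rw [real_update_one_eq w hw, real_update_one_eq w hw]
  congr 1
  ext ω
  simp only [mem_preimage, mem_setOf_eq]
  have hfo : (A.filter fun x => insert s(o, v) ω ∈ openConn o x) =
      (A.filter fun z => ω ∈ openConn o z ∨ ω ∈ openConn v z) := by
    refine Finset.filter_congr fun x _ => ?_
    exact reachable_insert_left_iff ω hov x
  rw [hfo]
  constructor
  · intro h
    refine ⟨Finset.card_pos.2 ⟨v, Finset.mem_filter.2 ⟨hv, Or.inr ?_⟩⟩, h⟩
    exact (SimpleGraph.Reachable.refl v : (openGraph ω).Reachable v v)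
  · rintro ⟨-, h⟩
    exact h

open ChampionStability in
/-- **Merge stability for a relay partner, hypothesis on the observer's side.**  If `v ∈ A`, `c ∈ A`, `v ≠ o`,
`w s(o,v) = 0` and `μ_w(|π(o)| ≤ j) ≤ μ_w(R_c)`, then `μ_{w[ov↦1]}(1 ≤ |π(o)| ≤ j) ≤ μ_{w[ov↦1]}(R_c)`.
(As the tree's `mergeStability_of_mem`, with `twoObserver_le_of_lonelier` applied to `(x,y) = (v,o)` and only that hypothesis.)
[cite: VandenbergHaggstromKahn2005, Thm. 1.5 (p. 7) — via Literature…twoObserver_le_of_lonelier] -/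
theorem mergeStability_obs_of_le (w : Sym2 (Fin n) → unitInterval) (A : Finset (Fin n))
    (o v c : Fin n) (j : ℕ) (hvo : v ≠ o) (hc : c ∈ A) (hw : w s(o, v) = 0)
    (hle : (prodBernoulli w).real {ω : BondConfig (Fin n) | (A.filter fun x => ω ∈ openConn o x).card ≤ j} ≤
      (prodBernoulli w).real {ω : BondConfig (Fin n) | (A.filter fun x => ω ∈ openConn c x).card ≤ j}) :
    (prodBernoulli (Function.update w s(o, v) 1)).real {ω : BondConfig (Fin n) |
        1 ≤ (A.filter fun x => ω ∈ openConn o x).card ∧ (A.filter fun x => ω ∈ openConn o x).card ≤ j} ≤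
      (prodBernoulli (Function.update w s(o, v) 1)).real {ω : BondConfig (Fin n) |
        (A.filter fun x => ω ∈ openConn c x).card ≤ j} := by
  have hov : o ≠ v := fun h => hvo h.symm
  set μ₁ := prodBernoulli (Function.update w s(o, v) 1) with hμ₁
  set L₁ : Set (BondConfig (Fin n)) := {ω | 1 ≤ (A.filter fun x => ω ∈ openConn o x).card ∧
      (A.filter fun x => ω ∈ openConn o x).card ≤ j} with hL₁
  set R₁ : Set (BondConfig (Fin n)) := {ω | (A.filter fun x => ω ∈ openConn c x).card ≤ j} with hR₁
  set C : Set (BondConfig (Fin n)) := openConn o c with hC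
  have hsplit : ∀ S : Set (BondConfig (Fin n)), μ₁.real S = μ₁.real (S ∩ C) + μ₁.real (S \ C) :=
    fun S => (measureReal_inter_add_sdiff (μ := μ₁) (s := S) (Set.toFinite C).measurableSet).symm
  have hLC : L₁ ∩ C = R₁ ∩ C := by
    ext ω
    simp only [hL₁, hR₁, hC, mem_inter_iff, mem_setOf_eq]
    constructor
    · rintro ⟨⟨-, h2⟩, hoc⟩
      have hoc' : (openGraph ω).Reachable o c := hoc
      have heq : (A.filter fun x => ω ∈ openConn c x) = (A.filter fun x => ω ∈ openConn o x) := by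
        refine Finset.filter_congr fun x _ => ⟨fun h => ?_, fun h => ?_⟩
        · exact hoc'.trans h
        · exact hoc'.symm.trans h
      rw [heq]
      exact ⟨h2, hoc⟩
    · rintro ⟨h2, hoc⟩
      have hoc' : (openGraph ω).Reachable o c := hoc
      have heq : (A.filter fun x => ω ∈ openConn o x) = (A.filter fun x => ω ∈ openConn c x) := by
        refine Finset.filter_congr fun x _ => ⟨fun h => ?_, fun h => ?_⟩
        · exact hoc'.symm.trans h
        · exact hoc'.trans h
      rw [heq]
      refine ⟨⟨Finset.card_pos.2 ⟨c, Finset.mem_filter.2 ⟨hc, ?_⟩⟩, h2⟩, hoc⟩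
      exact SimpleGraph.Reachable.refl c
  have hLoff : μ₁.real (L₁ \ C) = (prodBernoulli w).real {ω : BondConfig (Fin n) |
      ω ∉ openConn c v ∧ ω ∉ openConn c o ∧
      1 ≤ (A.filter fun z => ω ∈ openConn v z ∨ ω ∈ openConn o z).card ∧
      (A.filter fun z => ω ∈ openConn v z ∨ ω ∈ openConn o z).card ≤ j} := by
    rw [hμ₁, real_update_one_eq w hw]
    congr 1
    ext ω
    simp only [hL₁, hC, mem_preimage, mem_sdiff, mem_setOf_eq]
    have hfilt : (A.filter fun x => insert s(o, v) ω ∈ openConn o x) =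
        (A.filter fun z => ω ∈ openConn v z ∨ ω ∈ openConn o z) := by
      refine Finset.filter_congr fun x _ => ?_
      show (openGraph (insert s(o, v) ω)).Reachable o x ↔
        ((openGraph ω).Reachable v x ∨ (openGraph ω).Reachable o x)
      rw [reachable_insert_left_iff ω hov x]
      exact Or.comm
    have hco : insert s(o, v) ω ∈ openConn o c ↔ (ω ∈ openConn c o ∨ ω ∈ openConn c v) := by
      show (openGraph (insert s(o, v) ω)).Reachable o c ↔
        ((openGraph ω).Reachable c o ∨ (openGraph ω).Reachable c v)
      rw [SimpleGraph.reachable_comm]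
      exact reachable_insert_to_left_iff ω hov c
    rw [hfilt, hco]
    tauto
  have hRoff : μ₁.real (R₁ \ C) = (prodBernoulli w).real {ω : BondConfig (Fin n) |
      ω ∉ openConn c v ∧ ω ∉ openConn c o ∧ (A.filter fun z => ω ∈ openConn c z).card ≤ j} := by
    rw [hμ₁, real_update_one_eq w hw]
    congr 1
    ext ω
    simp only [hR₁, hC, mem_preimage, mem_sdiff, mem_setOf_eq]
    have hco : insert s(o, v) ω ∈ openConn o c ↔ (ω ∈ openConn c o ∨ ω ∈ openConn c v) := by
      show (openGraph (insert s(o, v) ω)).Reachable o c ↔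
        ((openGraph ω).Reachable c o ∨ (openGraph ω).Reachable c v)
      rw [SimpleGraph.reachable_comm]
      exact reachable_insert_to_left_iff ω hov c
    rw [hco]
    constructor
    · rintro ⟨hcard, hnot⟩
      have hco' : ¬ (openGraph ω).Reachable c o := fun h => hnot (Or.inl h)
      have hcv' : ¬ (openGraph ω).Reachable c v := fun h => hnot (Or.inr h)
      have hfilt : (A.filter fun x => insert s(o, v) ω ∈ openConn c x) =
          (A.filter fun z => ω ∈ openConn c z) := by
        refine Finset.filter_congr fun x _ => ?_
        exact reachable_insert_iff_of_not ω hov hco' hcv' x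
      rw [hfilt] at hcard
      exact ⟨hcv', hco', hcard⟩
    · rintro ⟨hcv', hco', hcard⟩
      have hfilt : (A.filter fun x => insert s(o, v) ω ∈ openConn c x) =
          (A.filter fun z => ω ∈ openConn c z) := by
        refine Finset.filter_congr fun x _ => ?_
        exact reachable_insert_iff_of_not ω hov hco' hcv' x
      rw [hfilt]
      exact ⟨hcard, fun h => h.elim hco' hcv'⟩
  have key := twoObserver_le_of_lonelier w A v o c j hle
  rw [hsplit L₁, hsplit R₁, hLC, hLoff, hRoff]
  linarith



/-- Raising one more star pair to weight `1` is a `Function.update` of the scenario weights. [this file] -/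
theorem scenario_insert (w : Sym2 (Fin n) → unitInterval) (E T₀ : Finset (Sym2 (Fin n))) (e : Sym2 (Fin n))
    (heT₀ : e ∉ T₀) :
    (fun e' => if e' ∈ insert e T₀ then (1 : unitInterval) else if e' ∈ E then 0 else w e') =
      Function.update (fun e' => if e' ∈ T₀ then (1 : unitInterval) else if e' ∈ E then 0 else w e') e 1 := by
  funext e'
  by_cases h : e' = e
  · subst h
    simp [Function.update]
  · rw [Function.update_of_ne h]
    simp [Finset.mem_insert, h]

/-- **The invariant.**  Let `v ∉ A`, `c ∈ A`, `E = {s(v,b) : b ∈ A}`, and suppose `c` is a champion of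
`w0 = (0 on E, w elsewhere)`.  Then for every nonempty `T ⊆ E`, in the scenario weights `w_T = (1 on T, 0 on E ∖ T,
w elsewhere)` (the vertex `v` glued to the relays of `T`), `μ_{w_T}(|π(v)| ≤ j) ≤ μ_{w_T}(|π(c)| ≤ j)`.
Induction on `T`: first pair by the tree's `mergeStability_of_mem`, further pairs by `mergeStability_obs_of_le`. [this file] -/
theorem glued_le (w : Sym2 (Fin n) → unitInterval) (A : Finset (Fin n)) (v c : Fin n) (j : ℕ)
    (hv : v ∉ A) (hc : c ∈ A)
    (hchamp : ∀ a ∈ A,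
      (prodBernoulli (fun e => if e ∈ A.image (fun b => s(v, b)) then (0 : unitInterval) else w e)).real
          {ω : BondConfig (Fin n) | (A.filter fun x => ω ∈ openConn a x).card ≤ j} ≤
        (prodBernoulli (fun e => if e ∈ A.image (fun b => s(v, b)) then (0 : unitInterval) else w e)).real
          {ω : BondConfig (Fin n) | (A.filter fun x => ω ∈ openConn c x).card ≤ j}) :
    ∀ T : Finset (Sym2 (Fin n)), T ⊆ A.image (fun b => s(v, b)) → T.Nonempty →
      (prodBernoulli (fun e => if e ∈ T then (1 : unitInterval) else
          if e ∈ A.image (fun b => s(v, b)) then 0 else w e)).real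
          {ω : BondConfig (Fin n) | (A.filter fun x => ω ∈ openConn v x).card ≤ j} ≤
        (prodBernoulli (fun e => if e ∈ T then (1 : unitInterval) else
          if e ∈ A.image (fun b => s(v, b)) then 0 else w e)).real
          {ω : BondConfig (Fin n) | (A.filter fun x => ω ∈ openConn c x).card ≤ j} := by
  set E := A.image (fun b => s(v, b)) with hE
  intro T
  induction T using Finset.induction_on with
  | empty => intro _ hne; exact absurd hne Finset.not_nonempty_empty
  | @insert e T₀ heT₀ ih =>
    intro hT _
    have he : e ∈ E := hT (Finset.mem_insert_self e T₀)
    have hT₀ : T₀ ⊆ E := fun x hx => hT (Finset.mem_insert_of_mem hx)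
    obtain ⟨b, hb, hbe⟩ := Finset.mem_image.1 he
    subst hbe
    have hbv : b ≠ v := fun h => hv (h ▸ hb)
    -- the scenario weights before raising `s(v,b)`
    set w₀ : Sym2 (Fin n) → unitInterval := fun e' => if e' ∈ T₀ then 1 else if e' ∈ E then 0 else w e'
      with hw₀
    have hupd : (fun e' => if e' ∈ insert s(v, b) T₀ then (1 : unitInterval) else if e' ∈ E then 0 else w e') =
        Function.update w₀ s(v, b) 1 := scenario_insert w E T₀ s(v, b) heT₀
    have hw₀e : w₀ s(v, b) = 0 := by
      show (if s(v, b) ∈ T₀ then (1 : unitInterval) else if s(v, b) ∈ E then 0 else w s(v, b)) = 0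
      rw [if_neg heT₀, if_pos he]
    rw [hupd, real_update_one_obs_lonely_eq w₀ A v b j hbv hb hw₀e]
    rcases T₀.eq_empty_or_nonempty with hT₀e | hT₀ne
    · -- first glued relay: HUB-MOVE from the champion comparison in `w0 = w₀`
      have hw₀0 : w₀ = (fun e' => if e' ∈ E then (0 : unitInterval) else w e') := by
        funext e'
        show (if e' ∈ T₀ then (1 : unitInterval) else if e' ∈ E then 0 else w e') = _
        rw [hT₀e, if_neg (Finset.notMem_empty e')]
      have hch' : ∀ a ∈ A,
          (prodBernoulli w₀).real {ω : BondConfig (Fin n) | (A.filter fun x => ω ∈ openConn a x).card ≤ j} ≤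
          (prodBernoulli w₀).real {ω : BondConfig (Fin n) | (A.filter fun x => ω ∈ openConn c x).card ≤ j} := by
        rw [hw₀0]; exact hchamp
      exact mergeStability_of_mem n w₀ A v b c j hv hbv hb hc hw₀e hch'
    · exact mergeStability_obs_of_le w₀ A v b c j hbv hc hw₀e (ih hT₀ hT₀ne)


/-- If no pair at `v` is open, nothing else is reachable from `v`. [folklore] -/
theorem not_reachable_of_no_edge (ω : BondConfig (Fin n)) (v x : Fin n) (hxv : x ≠ v)
    (h : ∀ y : Fin n, y ≠ v → s(v, y) ∉ ω) : ¬ (openGraph ω).Reachable v x := by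
  rintro ⟨p⟩
  cases p with
  | nil => exact hxv rfl
  | cons hadj _ =>
    rw [openGraph_adj] at hadj
    exact h _ (fun hyv => hadj.2 hyv.symm) hadj.1

/-- **The scenario `T = ∅`.**  With `v`'s star removed (`w0`), `v` is almost surely isolated (its non-relay pairs
have weight `0` by the star hypothesis), so the CS₂ pair `(u,v)` reduces to the single star observer `u`, for which the
cumulative isolation lemma holds at the champion `c` of `w0` (`cumulativeIsolation_of_relayNeighbours`). [this file] -/
theorem slice_empty (w : Sym2 (Fin n) → unitInterval) (A : Finset (Fin n)) (u v c : Fin n) (j : ℕ)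
    (hu : u ∉ A) (hv : v ∉ A) (huv : u ≠ v) (hc : c ∈ A)
    (hustar : ∀ x : Fin n, x ∉ A → x ≠ u → w s(u, x) = 0)
    (hvstar : ∀ x : Fin n, x ∉ A → x ≠ v → w s(v, x) = 0)
    (hchamp : ∀ a ∈ A,
      (prodBernoulli (fun e => if e ∈ A.image (fun b => s(v, b)) then (0 : unitInterval) else w e)).real
          {ω : BondConfig (Fin n) | (A.filter fun x => ω ∈ openConn a x).card ≤ j} ≤
        (prodBernoulli (fun e => if e ∈ A.image (fun b => s(v, b)) then (0 : unitInterval) else w e)).real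
          {ω : BondConfig (Fin n) | (A.filter fun x => ω ∈ openConn c x).card ≤ j}) :
    (prodBernoulli (fun e => if e ∈ A.image (fun b => s(v, b)) then (0 : unitInterval) else w e)).real
        {ω : BondConfig (Fin n) | ω ∉ openConn c u ∧ ω ∉ openConn c v ∧
          1 ≤ (A.filter fun z => ω ∈ openConn u z ∨ ω ∈ openConn v z).card ∧
          (A.filter fun z => ω ∈ openConn u z ∨ ω ∈ openConn v z).card ≤ j} ≤
      (prodBernoulli (fun e => if e ∈ A.image (fun b => s(v, b)) then (0 : unitInterval) else w e)).real
        {ω : BondConfig (Fin n) | ω ∉ openConn c u ∧ ω ∉ openConn c v ∧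
          (A.filter fun z => ω ∈ openConn c z).card ≤ j} := by
  set E := A.image (fun b => s(v, b)) with hE
  set w0 : Sym2 (Fin n) → unitInterval := fun e => if e ∈ E then 0 else w e with hw0
  set μ := prodBernoulli w0 with hμ
  have hmeas : ∀ S : Set (BondConfig (Fin n)), MeasurableSet S := fun _ => MeasurableSet.of_discrete
  -- the null set: some pair at `v` is open
  set F : Finset (Sym2 (Fin n)) := (Finset.univ.filter fun y : Fin n => y ≠ v).image (fun y => s(v, y)) with hF
  set Z : Set (BondConfig (Fin n)) := {ω | ∃ e ∈ F, e ∈ ω} with hZ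
  have hF0 : ∀ e ∈ F, (w0 e : ℝ) = 0 := by
    intro e he
    obtain ⟨y, hy, rfl⟩ := Finset.mem_image.1 he
    have hyv : y ≠ v := (Finset.mem_filter.1 hy).2
    show ((if s(v, y) ∈ E then (0 : unitInterval) else w s(v, y) : unitInterval) : ℝ) = 0
    by_cases hyE : s(v, y) ∈ E
    · simp [hyE]
    · have hyA : y ∉ A := fun hyA => hyE (Finset.mem_image.2 ⟨y, hyA, rfl⟩)
      simp [hyE, hvstar y hyA hyv]
  have hZ0 : μ.real Z = 0 := by
    rw [measureReal_def, hμ, prodBernoulli_setOf_exists_mem_eq_zero w0 F hF0, ENNReal.toReal_zero]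
  have hiso : ∀ ω : BondConfig (Fin n), ω ∉ Z → ∀ x : Fin n, x ≠ v → ¬ (openGraph ω).Reachable v x := by
    intro ω hω x hxv
    refine not_reachable_of_no_edge ω v x hxv fun y hyv hy => hω ?_
    exact ⟨s(v, y), Finset.mem_image.2 ⟨y, Finset.mem_filter.2 ⟨Finset.mem_univ y, hyv⟩, rfl⟩, hy⟩
  have hcv : c ≠ v := fun h => hv (h ▸ hc)
  -- single-observer events
  set C : Set (BondConfig (Fin n)) := openConn c u with hC
  set Au : Set (BondConfig (Fin n)) := {ω | 1 ≤ (A.filter fun x => ω ∈ openConn u x).card ∧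
      (A.filter fun x => ω ∈ openConn u x).card ≤ j} with hAu
  set Rc : Set (BondConfig (Fin n)) := {ω | (A.filter fun x => ω ∈ openConn c x).card ≤ j} with hRc
  -- the pair events versus the single-observer events, off `Z`
  have hL : {ω : BondConfig (Fin n) | ω ∉ openConn c u ∧ ω ∉ openConn c v ∧
        1 ≤ (A.filter fun z => ω ∈ openConn u z ∨ ω ∈ openConn v z).card ∧
        (A.filter fun z => ω ∈ openConn u z ∨ ω ∈ openConn v z).card ≤ j} ⊆ (Au \ C) ∪ Z := by
    intro ω hω
    by_cases hωZ : ω ∈ Z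
    · exact Or.inr hωZ
    · obtain ⟨hcu, -, h1, h2⟩ := hω
      have hfilt : (A.filter fun z => ω ∈ openConn u z ∨ ω ∈ openConn v z) =
          (A.filter fun z => ω ∈ openConn u z) := by
        refine Finset.filter_congr fun z hz => ⟨fun h => h.elim id fun hvz => ?_, fun h => Or.inl h⟩
        exact absurd hvz (hiso ω hωZ z (fun hzv => hv (hzv ▸ hz)))
      rw [hfilt] at h1 h2
      exact Or.inl ⟨⟨h1, h2⟩, hcu⟩
  have hR : (Rc \ C) \ Z ⊆ {ω : BondConfig (Fin n) | ω ∉ openConn c u ∧ ω ∉ openConn c v ∧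
        (A.filter fun z => ω ∈ openConn c z).card ≤ j} := by
    rintro ω ⟨⟨hRc', hcu⟩, hωZ⟩
    refine ⟨hcu, fun hcv' => ?_, hRc'⟩
    have : (openGraph ω).Reachable v c := (hcv' : (openGraph ω).Reachable c v).symm
    exact hiso ω hωZ c hcv this
  -- CIL for the star observer `u` at the champion `c` of `w0`
  have hrel : ∀ x : Fin n, x ≠ u → 0 < (w0 s(u, x) : ℝ) → x ∈ A := by
    intro x hxu hpos
    by_contra hxA
    have hnotE : s(u, x) ∉ E := by
      intro hmem
      obtain ⟨b, hb, hbe⟩ := Finset.mem_image.1 hmem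
      rw [Sym2.eq_iff] at hbe
      rcases hbe with ⟨hvu, -⟩ | ⟨hvx, hbu⟩
      · exact huv hvu.symm
      · exact hu (hbu ▸ hb)
    have : (w0 s(u, x) : ℝ) = 0 := by
      show ((if s(u, x) ∈ E then (0 : unitInterval) else w s(u, x) : unitInterval) : ℝ) = 0
      simp [hnotE, hustar x hxA hxu]
    rw [this] at hpos
    exact lt_irrefl _ hpos
  obtain ⟨a, ha, hCIL⟩ := cumulativeIsolation_of_relayNeighbours n w0 A u j ⟨c, hc⟩ hu hrel
  have hAuRc : μ.real Au ≤ μ.real Rc := hCIL.trans (hchamp a ha)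
  have hAC : Au ∩ C = Rc ∩ C := by
    ext ω
    simp only [hAu, hRc, hC, mem_inter_iff, mem_setOf_eq]
    constructor
    · rintro ⟨⟨-, h2⟩, hcu⟩
      have hcu' : (openGraph ω).Reachable c u := hcu
      have heq : (A.filter fun x => ω ∈ openConn c x) = (A.filter fun x => ω ∈ openConn u x) :=
        Finset.filter_congr fun x _ => ⟨fun h => hcu'.symm.trans h, fun h => hcu'.trans h⟩
      rw [heq]; exact ⟨h2, hcu⟩
    · rintro ⟨h2, hcu⟩
      have hcu' : (openGraph ω).Reachable c u := hcu
      have heq : (A.filter fun x => ω ∈ openConn u x) = (A.filter fun x => ω ∈ openConn c x) :=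
        Finset.filter_congr fun x _ => ⟨fun h => hcu'.trans h, fun h => hcu'.symm.trans h⟩
      rw [heq]
      exact ⟨⟨Finset.card_pos.2 ⟨c, Finset.mem_filter.2 ⟨hc, SimpleGraph.Reachable.refl c⟩⟩, h2⟩, hcu⟩
  have hsA : μ.real Au = μ.real (Au ∩ C) + μ.real (Au \ C) :=
    (measureReal_inter_add_sdiff (μ := μ) (s := Au) (hmeas C)).symm
  have hsR : μ.real Rc = μ.real (Rc ∩ C) + μ.real (Rc \ C) :=
    (measureReal_inter_add_sdiff (μ := μ) (s := Rc) (hmeas C)).symm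
  have hkey : μ.real (Au \ C) ≤ μ.real (Rc \ C) := by rw [hAC] at hsA; linarith
  -- assemble with the null set
  have h1 : μ.real {ω : BondConfig (Fin n) | ω ∉ openConn c u ∧ ω ∉ openConn c v ∧
        1 ≤ (A.filter fun z => ω ∈ openConn u z ∨ ω ∈ openConn v z).card ∧
        (A.filter fun z => ω ∈ openConn u z ∨ ω ∈ openConn v z).card ≤ j} ≤ μ.real (Au \ C) := by
    refine (measureReal_mono hL).trans ?_
    refine (measureReal_union_le _ _).trans ?_
    simp only [hZ0, add_zero, le_refl]
  have h2 : μ.real (Rc \ C) ≤ μ.real {ω : BondConfig (Fin n) | ω ∉ openConn c u ∧ ω ∉ openConn c v ∧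
        (A.filter fun z => ω ∈ openConn c z).card ≤ j} := by
    have hsplit : μ.real (Rc \ C) = μ.real ((Rc \ C) ∩ Z) + μ.real ((Rc \ C) \ Z) :=
      (measureReal_inter_add_sdiff (μ := μ) (s := Rc \ C) (hmeas Z)).symm
    have hz : μ.real ((Rc \ C) ∩ Z) = 0 :=
      le_antisymm ((measureReal_mono inter_subset_right).trans hZ0.le) measureReal_nonneg
    rw [hsplit, hz, zero_add]
    exact measureReal_mono hR
  exact h1.trans (hkey.trans h2)

end StarPair

open StarPair in
/-- **CS₂ for two star ports when the champion survives one star.**  For bond percolation with arbitrary edge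
probabilities on `Fin n`, relays `A`, a level `j`, two distinct non-relay vertices `u, v` whose positive-weight
neighbours are all relays, and a relay `c` that is a champion of `w0 := w` with `v`'s star removed
(`μ_{w0}(|π(a)| ≤ j) ≤ μ_{w0}(|π(c)| ≤ j)` for all `a ∈ A`):
`μ_w(c ↮ u, c ↮ v, 1 ≤ |π(u) ∪ π(v)| ≤ j) ≤ μ_w(c ↮ u, c ↮ v, |π(c)| ≤ j)` — the conclusion of
`stub_championStabilityPair` at `(x, y) = (u, v)`.  Proof: scenario disintegration over `v`'s star pairs
(`HullPort.real_eq_sum_scenarios`), `StarPair.slice_empty` for the empty scenario and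
`Literature…twoObserver_le_of_lonelier` + `StarPair.glued_le` for the others.
[cite: VandenbergHaggstromKahn2005, Thm. 1.5 (p. 7); KozmaNitzan2024, Lemmas 1–2 — via the tree lemmas named] -/
theorem championStabilityPair_starPartner (w : Sym2 (Fin n) → unitInterval) (A : Finset (Fin n))
    (u v c : Fin n) (j : ℕ) (hu : u ∉ A) (hv : v ∉ A) (huv : u ≠ v) (hc : c ∈ A)
    (hustar : ∀ x : Fin n, x ∉ A → x ≠ u → w s(u, x) = 0)
    (hvstar : ∀ x : Fin n, x ∉ A → x ≠ v → w s(v, x) = 0)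
    (hchamp : ∀ a ∈ A,
      (prodBernoulli (fun e => if e ∈ A.image (fun b => s(v, b)) then (0 : unitInterval) else w e)).real
          {ω : BondConfig (Fin n) | (A.filter fun x => ω ∈ openConn a x).card ≤ j} ≤
        (prodBernoulli (fun e => if e ∈ A.image (fun b => s(v, b)) then (0 : unitInterval) else w e)).real
          {ω : BondConfig (Fin n) | (A.filter fun x => ω ∈ openConn c x).card ≤ j}) :
    (prodBernoulli w).real {ω : BondConfig (Fin n) | ω ∉ openConn c u ∧ ω ∉ openConn c v ∧
        1 ≤ (A.filter fun z => ω ∈ openConn u z ∨ ω ∈ openConn v z).card ∧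
        (A.filter fun z => ω ∈ openConn u z ∨ ω ∈ openConn v z).card ≤ j} ≤
      (prodBernoulli w).real {ω : BondConfig (Fin n) | ω ∉ openConn c u ∧ ω ∉ openConn c v ∧
        (A.filter fun z => ω ∈ openConn c z).card ≤ j} := by
  set E := A.image (fun b => s(v, b)) with hE
  rw [HullPort.real_eq_sum_scenarios E w, HullPort.real_eq_sum_scenarios E w]
  refine Finset.sum_le_sum fun T hT => ?_
  have hTE : T ⊆ E := Finset.mem_powerset.1 hT
  have hcoef : 0 ≤ (∏ e ∈ T, (w e : ℝ)) * ∏ e ∈ E \ T, (1 - (w e : ℝ)) :=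
    mul_nonneg (Finset.prod_nonneg fun e _ => (w e).2.1)
      (Finset.prod_nonneg fun e _ => sub_nonneg.2 (w e).2.2)
  refine mul_le_mul_of_nonneg_left ?_ hcoef
  rcases T.eq_empty_or_nonempty with hT0 | hTne
  · subst hT0
    have h0 : (fun e => if e ∈ (∅ : Finset (Sym2 (Fin n))) then (1 : unitInterval) else if e ∈ E then 0 else w e) =
        (fun e => if e ∈ E then (0 : unitInterval) else w e) := by
      funext e; rw [if_neg (Finset.notMem_empty e)]
    rw [h0]
    exact slice_empty w A u v c j hu hv huv hc hustar hvstar hchamp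
  · exact twoObserver_le_of_lonelier _ A u v c j (glued_le w A v c j hv hc hchamp T hTE hTne)

end Summit.CriticalPhenomena.PercolationContinuityZ3.Theorems

end
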